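import Summits.KontsevichZagierPeriods.KontsevichZagierPeriods.Theorems.RootDecompWalshStrataPolarChart05
import Summits.KontsevichZagierPeriods.KontsevichZagierPeriods.Theorems.RootDecompWalshStrataEulerDescent11

/-!
# Root decomposition & Walsh strata — one E-type sector END TO END (gen 8, §33)

The critic's test of the gen-7 instrument (CRITIC-LEDGER rows 118/119: «compile one full E-type sector
example end-to-end»).  The specimen is the POINTLESS positive-definite fibre discriminant
`D = 3x² + 3y² − 1` (the conic `u² = D` has no rational point, so no fibrewise Euler chart over `ℚ`
exists in any rational direction) with the weight `γ√D` over the part of the unit square where `D > 0`: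

  `inBaker_posdef_specimen : [ {0 < x, y < 1, 3x² + 3y² > 1}, γ√(3x² + 3y² − 1) ] ∈ InBaker`.

Every move is one of KZ's rules (1)–(3) as typed in the tree (`InBaker.*` of the landed chain) or in the
farm-checked gen-7 chart file (`RootDecompWalshStrataPolarChart01–05`):
* rule (1): the domain is cut along the diagonal into the sector `A = {0 < y < x < 1, D > 0}`, its mirror
  image and the null diagonal (`InBaker.of_partition`, `InBaker.of_subset_zeroSet`);
* rule (2): the mirror sector is the swap image of `A` (`InBaker.of_swap`);
* rules (2)+(3): `A` goes through the elliptic-polar chart with `κ₀ = κ₁ = 1/2`, `a = 6`, `c = −1`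
  (`D = a(κ₀x² + κ₁y²) + c`; `InBaker.of_psector`: chart, Newton–Leibniz in `r` over the cylindrical
  decomposition of the chart domain, cancellation of interior sections), leaving the BOUNDARY SECTION TERMS
  `[S, P(t, ζ t)]` of the primitive `P = ppot`;
* the new part (§33.1–33.4): WHERE those sections live and WHAT they are.  `frontier_pchartDom_subset`
  localises every frontier point `(t, r)` of a chart domain over an open target `T ⊆ C` (`C` closed):
  `r ≥ 0`, `Φ(t, r) ∈ C`, and `Φ(t, r) ∉ T` when `r > 0`.  For the specimen this forces (`specA_frontier`)
  `0 ≤ t ≤ 1`, `r > 0` and one of four WALLS: `t = 0`, `t = 1` (null endpoints, rule (1a)),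
  `2r² = 1 + t²` (the line wall `x = 1`, on which `P = (γ/9)(3t² + 2)/(1 + t²)·√(3t² + 2)` — the landed
  Euler terminal `InBaker.sqrt_rational`), or `6r² = 1` (the conic wall `D = 0`, on which `P ≡ 0`).
  The hereditary cover lemma `InBaker.of_cover` dispatches an arbitrary section `(S, ζ)` over the walls.

No `sorry`, no new axioms; the statement quantifies over every representation `ρ` with that domain and
integrand, exactly in the shape the route items (`SqrtDescentW`, `QuadricBakerDescent`) consume.
[KontsevichZagier2001 §1.2 rules (1)–(3); BCR1998 §2.2; this node]
-/

/-! # `RootDecompWalshStrataSectorSpecimenP1` — part 1/2 of the mechanical ≤330-line split of `RootDecompWalshStrataSectorSpecimen.lean`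
(split by the decomp-kz census seat for landing; mathematics unchanged). -/

noncomputable section

open Set MeasureTheory MvPolynomial Literature.NumberTheory.Transcendental
open Literature.ModelTheory.ExponentialFields (IsSemialgebraic isSemialgebraic_univ isSemialgebraic_setOf_eval_pos
  isSemialgebraic_setOf_eval_eq_zero isSemialgebraic_setOf_eval_lt)

namespace Summit.KontsevichZagierPeriods.RootDecompWalshStrata.ConicDescent.BallCube

/-! #### 33.1 Where the boundary sections of a chart domain live -/

variable {κ₀ κ₁ : ℚ}

/-- `(x, t)₀ = x₀` on `Fin 2` (rfl helper; the landed twins are private). [folklore] -/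
@[simp] private theorem snoc2_zero (x : Fin 1 → ℝ) (t : ℝ) : (Fin.snoc x t : Fin 2 → ℝ) 0 = x 0 := rfl

/-- `(x, t)₁ = t` on `Fin 2` (rfl helper). [folklore] -/
@[simp] private theorem snoc2_one (x : Fin 1 → ℝ) (t : ℝ) : (Fin.snoc x t : Fin 2 → ℝ) 1 = t := rfl

/-- **FRONTIER LOCALISATION.**  For an open target `T` inside a closed set `C`, a frontier point
`p = (t, r)` of the chart domain `pchartDom κ₀ κ₁ T = {r > 0, Φ(t, r) ∈ T}` satisfies `r ≥ 0`,
`Φ(p) ∈ C`, and `Φ(p) ∉ T` unless `r ≤ 0` (closure of a preimage under the continuous chart, and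
`frontier W ∩ W = ∅` for open `W`).  This is what makes the section hypothesis of `InBaker.of_psector`
COMPUTABLE: the walls of `T` pulled back through `Φ`. [this node] -/
theorem frontier_pchartDom_subset (hκ : 0 < κ₀ ∧ 0 ≤ κ₁) {T C : Set (Fin 2 → ℝ)} (hT : IsOpen T)
    (hC : IsClosed C) (hTC : T ⊆ C) :
    frontier (pchartDom κ₀ κ₁ T) ⊆
      {p | 0 ≤ p 1 ∧ pΦ κ₀ κ₁ p ∈ C ∧ (0 < p 1 → pΦ κ₀ κ₁ p ∉ T)} := by
  intro p hp
  have hcl : p ∈ closure (pchartDom κ₀ κ₁ T) := frontier_subset_closure hp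
  have hno : p ∉ pchartDom κ₀ κ₁ T := fun h => by
    have h' : p ∈ pchartDom κ₀ κ₁ T ∩ frontier (pchartDom κ₀ κ₁ T) := ⟨h, hp⟩
    rw [(isOpen_pchartDom hκ hT).inter_frontier_eq] at h'
    exact h'
  have h1 : closure (pchartDom κ₀ κ₁ T) ⊆ {p : Fin 2 → ℝ | 0 ≤ p 1} ∩ pΦ κ₀ κ₁ ⁻¹' C := by
    rw [show pchartDom κ₀ κ₁ T = {p : Fin 2 → ℝ | 0 < p 1} ∩ pΦ κ₀ κ₁ ⁻¹' T from rfl]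
    refine (closure_inter_subset_inter_closure _ _).trans (inter_subset_inter ?_ ?_)
    · exact closure_lt_subset_le continuous_const (continuous_apply 1)
    · exact closure_minimal (preimage_mono hTC) (hC.preimage (continuous_pΦ hκ))
  obtain ⟨h0, hC'⟩ := h1 hcl
  exact ⟨h0, hC', fun hr hT' => hno ⟨hr, hT'⟩⟩

/-! #### 33.2 The specimen: `D = 3x² + 3y² − 1 = 6·(x²/2 + y²/2) − 1`, sector `0 < y < x < 1` -/

/-- The chart weights of the specimen: `κ₀ = κ₁ = 1/2`. [this node] -/
theorem hκ_half : (0 : ℚ) < 1 / 2 ∧ (0 : ℚ) ≤ 1 / 2 := by norm_num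

/-- The specimen's domain: the part of the open unit square where `3x² + 3y² > 1`. [this node] -/
def specT : Set (Fin 2 → ℝ) := {w | (∀ j, 0 < w j ∧ w j < 1) ∧ 1 < 3 * w 0 ^ 2 + 3 * w 1 ^ 2}

/-- The specimen's SECTOR `A = {0 < y < x < 1, 3x² + 3y² > 1}` (open). [this node] -/
def specA : Set (Fin 2 → ℝ) :=
  {w | (0 < w 1 ∧ w 1 < w 0 ∧ w 0 < 1) ∧ 1 < 3 * w 0 ^ 2 + 3 * w 1 ^ 2}

/-- A closed set containing the sector (its non-strict hull). [this node] -/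
def specC : Set (Fin 2 → ℝ) :=
  {w | (0 ≤ w 1 ∧ w 1 ≤ w 0 ∧ w 0 ≤ 1) ∧ 1 ≤ 3 * w 0 ^ 2 + 3 * w 1 ^ 2}

/-- Auxiliary step `isOpen_specA`. [bookkeeping] -/
theorem isOpen_specA : IsOpen specA := by
  have h0 : Continuous fun w : Fin 2 → ℝ => w 0 := continuous_apply 0
  have h1 : Continuous fun w : Fin 2 → ℝ => w 1 := continuous_apply 1
  have hq : Continuous fun w : Fin 2 → ℝ => 3 * w 0 ^ 2 + 3 * w 1 ^ 2 := by fun_prop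
  simp only [specA, setOf_and]
  exact ((isOpen_lt continuous_const h1).inter ((isOpen_lt h1 h0).inter
    (isOpen_lt h0 continuous_const))).inter (isOpen_lt continuous_const hq)

/-- Auxiliary step `isClosed_specC`. [bookkeeping] -/
theorem isClosed_specC : IsClosed specC := by
  have h0 : Continuous fun w : Fin 2 → ℝ => w 0 := continuous_apply 0
  have h1 : Continuous fun w : Fin 2 → ℝ => w 1 := continuous_apply 1
  have hq : Continuous fun w : Fin 2 → ℝ => 3 * w 0 ^ 2 + 3 * w 1 ^ 2 := by fun_prop
  simp only [specC, setOf_and]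
  exact ((isClosed_le continuous_const h1).inter ((isClosed_le h1 h0).inter
    (isClosed_le h0 continuous_const))).inter (isClosed_le continuous_const hq)

/-- `specA ⊆ specC`. [bookkeeping] -/
theorem specA_subset_specC : specA ⊆ specC := fun _ ⟨⟨h1, h10, h01⟩, hq⟩ =>
  ⟨⟨h1.le, h10.le, h01.le⟩, hq.le⟩

/-- The sector lies in the open unit square. [this node] -/
theorem specA_box {w : Fin 2 → ℝ} (hw : w ∈ specA) : ∀ j, 0 < w j ∧ w j < 1 := by
  obtain ⟨⟨h1, h10, h01⟩, -⟩ := hw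
  exact Fin.forall_fin_two.2 ⟨⟨h1.trans h10, h01⟩, h1, h10.trans h01⟩

/-- `specA ⊆ Icc`. [bookkeeping] -/
theorem specA_subset_Icc : specA ⊆ Icc (0 : Fin 2 → ℝ) 1 := fun _ hw =>
  ⟨fun j => ((specA_box hw) j).1.le, fun j => ((specA_box hw) j).2.le⟩

/-- `specT ∩ {y < x} = A`. [this node] -/
theorem specT_inter_lt : specT ∩ {w | w 1 < w 0} = specA := by
  ext w
  simp only [specT, specA, mem_inter_iff, mem_setOf_eq, Fin.forall_fin_two]
  constructor
  · rintro ⟨⟨⟨⟨-, h01⟩, h1, -⟩, hq⟩, hlt⟩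
    exact ⟨⟨h1, hlt, h01⟩, hq⟩
  · rintro ⟨⟨h1, hlt, h01⟩, hq⟩
    exact ⟨⟨⟨⟨h1.trans hlt, h01⟩, h1, hlt.trans h01⟩, hq⟩, hlt⟩

/-- `swap (specT ∩ {x < y}) = A`. [this node] -/
theorem swap_image_specT_inter_gt : AffMap.swap.toFun '' (specT ∩ {w | w 0 < w 1}) = specA := by
  ext w
  simp only [specT, specA, mem_image, mem_inter_iff, mem_setOf_eq, Fin.forall_fin_two]
  constructor
  · rintro ⟨p, ⟨⟨⟨⟨h00, -⟩, -, h11⟩, hq⟩, hlt⟩, rfl⟩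
    simp only [AffMap.swap_toFun_zero, AffMap.swap_toFun_one]
    exact ⟨⟨h00, hlt, h11⟩, by linarith⟩
  · rintro ⟨⟨h1, hlt, h01⟩, hq⟩
    refine ⟨AffMap.swap.toFun w, ?_, ?_⟩
    · simp only [AffMap.swap_toFun_zero, AffMap.swap_toFun_one]
      exact ⟨⟨⟨⟨h1, hlt.trans h01⟩, h1.trans hlt, h01⟩, by linarith⟩, hlt⟩
    · funext i
      fin_cases i <;> simp [AffMap.swap]

/-- The specimen's weight in chart form: `γ√(6(x²/2 + y²/2) − 1) = γ√(3x² + 3y² − 1)`. [this node] -/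
theorem ellW_spec (γ : ℚ) (w : Fin 2 → ℝ) :
    ellW (1 / 2) (1 / 2) γ 6 (-1) w = (γ : ℝ) * √(3 * w 0 ^ 2 + 3 * w 1 ^ 2 - 1) := by
  have h : ((6 : ℚ) : ℝ) * (((1 / 2 : ℚ) : ℝ) * w 0 ^ 2 + ((1 / 2 : ℚ) : ℝ) * w 1 ^ 2) + ((-1 : ℚ) : ℝ) =
      3 * w 0 ^ 2 + 3 * w 1 ^ 2 - 1 := by
    push_cast
    ring
  rw [ellW, h]

/-- Auxiliary step `isSemialgebraicFunOn_ellW_spec`. [bookkeeping] -/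
theorem isSemialgebraicFunOn_ellW_spec {s : Set (Fin 2 → ℝ)} (hs : IsSemialgebraic ℚ s) (γ : ℚ) :
    IsSemialgebraicFunOn ℚ s (ellW (1 / 2) (1 / 2) γ 6 (-1)) :=
  ((isSemialgebraicFunOn_ratCast hs γ).mul_holds (IsSemialgebraicFunOn.sqrt_holds
    (isSemialgebraicFunOn_aeval hs (3 * X 0 ^ 2 + 3 * X 1 ^ 2 - 1 : MvPolynomial (Fin 2) ℚ)))).congr
    fun w _ => by rw [ellW_spec]; simp

/-- Auxiliary step `abs_ellW_spec_le`. [bookkeeping] -/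
theorem abs_ellW_spec_le (γ : ℚ) {w : Fin 2 → ℝ} (hw : ∀ j, 0 < w j ∧ w j < 1) :
    |ellW (1 / 2) (1 / 2) γ 6 (-1) w| ≤ |(γ : ℝ)| * √5 := by
  rw [ellW_spec, abs_mul, abs_of_nonneg (Real.sqrt_nonneg _)]
  refine mul_le_mul_of_nonneg_left (Real.sqrt_le_sqrt ?_) (abs_nonneg _)
  obtain ⟨h00, h01⟩ := hw 0
  obtain ⟨h10, h11⟩ := hw 1
  nlinarith [mul_pos h00 (sub_pos.2 h01), mul_pos h10 (sub_pos.2 h11)]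

/-- The primitive `P = ppot` of the specimen at a section point `(t, s)`:
`P(t, s) = (γ/9)·(6s² − 1)/(1 + t²)·√(6s² − 1)`. [this node] -/
theorem ppot_spec (γ : ℚ) (x : Fin 1 → ℝ) (s : ℝ) :
    ppot (1 / 2) (1 / 2) γ 6 (-1) (Fin.snoc x s) =
      (γ : ℝ) / 9 * ((6 * s ^ 2 - 1) / (1 + x 0 ^ 2)) * √(6 * s ^ 2 - 1) := by
  rw [ppot, ph, snoc2_zero, snoc2_one]
  have hrad : ((6 : ℚ) : ℝ) * s ^ 2 + ((-1 : ℚ) : ℝ) = 6 * s ^ 2 - 1 := by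
    push_cast
    ring
  have hW : ((1 / 2 : ℚ) : ℝ) + ((1 / 2 : ℚ) : ℝ) * x 0 ^ 2 = (1 + x 0 ^ 2) / 2 := by
    push_cast
    ring
  rw [hrad, hW]
  have h1 : (1 : ℝ) + x 0 ^ 2 ≠ 0 := by positivity
  push_cast
  field_simp
  ring

/-! #### 33.3 The walls: where a boundary section of the specimen's chart domain can lie -/

/-- **WALLS OF THE SPECIMEN.**  A frontier point `(t, r)` of the chart domain over the sector `A` has
`0 ≤ t ≤ 1`, `r > 0`, and lies on one of: `t = 0` (the edge `y = 0`), `t = 1` (the diagonal),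
`2r² = 1 + t²` (the edge `x = 1`, since `x² + y² = 2r²` and `y = xt`), `6r² = 1` (the conic `D = 0`).
(`x = 0` is impossible for `r > 0`; `y = 1` forces `x = 1`.) [this node] -/
theorem specA_frontier {p : Fin 2 → ℝ} (hp : p ∈ frontier (pchartDom (1 / 2) (1 / 2) specA)) :
    (0 ≤ p 0 ∧ p 0 ≤ 1) ∧ 0 < p 1 ∧
      (p 0 = 0 ∨ p 0 = 1 ∨ 2 * p 1 ^ 2 = 1 + p 0 ^ 2 ∨ 6 * p 1 ^ 2 = 1) := by
  obtain ⟨h0, hC, hnA⟩ :=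
    frontier_pchartDom_subset hκ_half isOpen_specA isClosed_specC specA_subset_specC hp
  have hsq := pΦ_sq_add hκ_half p
  have hYX := pΦ_one_eq (κ₀ := 1 / 2) (κ₁ := 1 / 2) p
  obtain ⟨⟨hY0, hYX', hX1⟩, hQ⟩ := hC
  set X := pΦ (1 / 2) (1 / 2) p 0 with hXdef
  set Y := pΦ (1 / 2) (1 / 2) p 1 with hYdef
  push_cast at hsq
  -- `r > 0`: at `r = 0` the chart lands at the origin, outside `C`
  have hr : 0 < p 1 := by
    rcases h0.eq_or_lt with h | h
    · exfalso
      rw [← h] at hsq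
      nlinarith [sq_nonneg X, sq_nonneg Y]
    · exact h
  have hXp : 0 < X := pΦ_zero_pos hκ_half hr
  have ht0 : 0 ≤ p 0 := by
    have h := hY0
    rw [hYX] at h
    exact (mul_nonneg_iff_of_pos_left hXp).1 h
  have ht1 : p 0 ≤ 1 := by
    have h := hYX'
    rw [hYX] at h
    exact (mul_le_iff_le_one_right hXp).1 h
  refine ⟨⟨ht0, ht1⟩, hr, ?_⟩
  rcases hY0.eq_or_lt with h1 | h1
  · -- `y = 0`: `t = 0`
    left
    rcases mul_eq_zero.1 (hYX.symm.trans h1.symm) with h | h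
    · exact absurd h hXp.ne'
    · exact h
  rcases hYX'.eq_or_lt with h2 | h2
  · -- `y = x`: `t = 1`
    right; left
    exact mul_left_cancel₀ hXp.ne' (by rw [mul_one]; exact hYX.symm.trans h2)
  rcases hX1.eq_or_lt with h3 | h3
  · -- `x = 1`: `2r² = 1 + t²`
    right; right; left
    have hY' : Y = p 0 := by rw [hYX, h3, one_mul]
    rw [h3, hY'] at hsq
    linarith
  rcases hQ.eq_or_lt with h4 | h4
  · -- `D = 0`: `6r² = 1`
    right; right; right
    linarith
  · exact absurd ⟨⟨h1, h2, h3⟩, h4⟩ (hnA hr)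

/-! #### 33.4 The section dispatcher and the sector -/

end Summit.KontsevichZagierPeriods.RootDecompWalshStrata.ConicDescent.BallCube
end
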